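import Summits.CriticalPhenomena.Ising3DConformalLimit.Theses.ReflectionTwin
import Summits.CriticalPhenomena.Ising3DConformalLimit.Theorems.HyperoctahedralRPLimitRotationInvariant
import Summits.CriticalPhenomena.Ising3DConformalLimit.Theorems.HyperoctahedralRPHRP2Rigidity
import HarnessLib

/-!
# Item stmt-CriticalPhenomena-16909 `ReflectionTwin.TwinTransfer` — proved (corollary of full `O(3)`-invariance)

Route `ReflectionTwin`, support item: for `(ρ, Δ, S)` as in `ExistsScaleCovariantLimit`, transparency of the twin through a
linear `A` plus lattice `τ`-symmetry imply `S k (θ ∘ w) = S k w` for the `(111)` reflection `θ`. Since every such limit is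
`O(3)`-invariant outright (items 1979 `HRP2Rigidity_of` ∧ 1980 `LimitRotationInvariant_of`, composed) and `θ`
(`Submodule.reflection`) is a linear isometry, the conclusion holds with the twin antecedent unused — the 4-line
closure found by the skeleton vet of crux stmt-16913 (`TwinTransferFromTree.lean`). [folklore]
-/

noncomputable section

namespace Summit.CriticalPhenomena.Ising3DConformalLimit.ReflectionTwinTwinTransfer

open Literature.Probability.LatticeModels
open Summit.CriticalPhenomena.Ising3DConformalLimit.Cruxes.LimitRotationInvariant.QuarterTurnLiouville
  (LimitRotationInvariant_of)
open Summit.CriticalPhenomena.Ising3DConformalLimit.Cruxes.HRP2Rigidity.XRayMellin (HRP2Rigidity_of)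

/-- **Item stmt-CriticalPhenomena-16909 `TwinTransfer` — proved** (rotation invariance of the limit; `θ` is a linear
isometry). [folklore] -/
theorem twinTransfer_proof :
    Summit.CriticalPhenomena.Ising3DConformalLimit.Theses.ReflectionTwin.TwinTransfer := by
  intro ρ Δ S hρ hlim hnorm hnd htr hsc _hex k w
  exact LimitRotationInvariant_of HRP2Rigidity_of ρ Δ S hρ hlim hnorm hnd htr hsc k _ w

end Summit.CriticalPhenomena.Ising3DConformalLimit.ReflectionTwinTwinTransfer

end
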